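import Summits.BirchSwinnertonDyer.BirchSwinnertonDyer.Theorems.PrintCFramBottomClassIndexLawFiveLeBorelNoPTorsion
import Summits.BirchSwinnertonDyer.Rank1Residual.X12.O11.RouteUTamagawaCM
import Summits.BirchSwinnertonDyer.Rank1Residual.X12.CMGoodOrdinarySplit
import Summits.BirchSwinnertonDyer.Rank1Residual.X11b.SplitPrimeUnramified
import Summits.BirchSwinnertonDyer.Rank1Residual.X11b.Three.StepLAtThree
import Summits.BirchSwinnertonDyer.BirchSwinnertonDyer.Theorems.SchneiderFreeUpperSockets
import Literature.NumberTheory.EllipticCurves.ModularityVersionApProofs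
import HarnessLib

/-!
# Crux `PrintCFram.BottomClassIndexLawFiveLe` (stmt-BirchSwinnertonDyer-20372), line `eisenstein-resource-bdp-line` v7, stub
# `stub_kolyvaginUpper_borelCM` (S2): the class-side INPUTS of Kolyvagin's argument at the Borel CM-ramified prime —
# frame corollaries of «no `p`-torsion», the Tamagawa-free currency of S2/S3, the homothety for (α), and the Heegner-field binders
# (cell `bsd-print-cfram`, width seat `bsd-line-cfram-p1-w4` g2; helper `--supports` 20372; THEOREMS ONLY, 0 facts, 0 definitions)

HONEST FRAMING. Nothing about BSD is proved and no stub is closed. Companion of `…BorelNoPTorsion.lean` (same seat), which proves on the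
crux's binders (`W.HasCM`, `CMRamified W p`, `5 ≤ p`) that `W(L)[p] = 0` for every quadratic field `L` and every finite Galois `L/ℚ`
unramified at `p`, from the inertia square `τ² ∈ I_𝔓` acting on the rational line and on its quotient by one scalar `a ≡ ±2`. Here the
remaining CLASS-SIDE inputs of the line `borel_heegner_squeeze`'s S2 (`stub_kolyvaginUpper_borelCM`, adopted into v7 by LEAD g6) and S3:

* §5 `torsionBy_eq_bot_heegnerField_of_cmRamified`, `eq_zero_of_prime_smul_eq_zero_of_cmRamified` (the `E(K)[p] = 0` clause of
  `SchneiderFree.Upper.AdditiveCoStepLInputManinAt` / hypothesis (β) of `Lines/borel-heegner-squeeze-H1check.md`, for every member and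
  every imaginary quadratic field); `padicValNat_tamagawaProduct_eq_zero_of_hasCM` (cell `bsd-cm`'s `RouteU.not_dvd_tamagawaProduct_of_hasCM`:
  no multiplicative prime, Kodaira–Néron `c_ℓ ≤ 4 < p`) and `indexUpperBoundLeAt_iff_of_hasCM` / `indexLowerBoundLeAt_iff_of_hasCM`: on the
  class S2 / S3 are the BARE inequalities `ord_p #Ш(W/K'') + 2s ≤ 2·ord_p[W(K''):ℤP]` / `≥` — the `2·ord_p ∏ c_ℓ` summand, which Jetchev's
  printed Thm. 1.1 only bounds by `2·max_q ord_p c_q` (barrier `StringentKolyvaginCapsAtMax`), is ABSENT here.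
* §6 `exists_sq_mem_inertia_homothety` — `(τ²)^p ∈ I_𝔓`, a square of `Γ_ℚ`, acts on ALL of `W[p](ℚ̄)` as the scalar `a^p ≡ a ≢ 1` (the
  unipotent part of `τ²` is killed by the `p`-th power: `φ^[p] = a^p + p a^{p−1} N`, `N² = 0` — the two algebra lemmas of §6): the CENTRAL
  element that Sah's lemma needs for (α) `H^i(Gal(L(W[p])/L), W[p]) = 0`, `i ≥ 1`, over every quadratic / `p`-unramified Galois `L` (Gross
  1991 §9; Lawson–Wuthrich 2016; `Lines/borel-heegner-squeeze-H1check.md` §(α) obtained it from a Frobenius homothety and CM reciprocity —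
  here from inertia, class-wide, kernel-checked).
* §7 the field-side binders at the Heegner field `K` of a member (`SatisfiesHeegnerHypothesis (N_W) K`): `p ∣ N_W`
  (`dvd_conductorNorm_of_cmRamified`), hence `p ∤ d_K ∧ p ∤ #𝓞_K^×` (`not_dvd_discr_and_not_dvd_torsionOrder_heegnerField_of_cmRamified`; the
  `¬ p ∣ Units.torsionOrder K` binder of S2/S3) and `K` unramified at `p` (`isUnramifiedIn_heegnerField_of_cmRamified`); packaged:
  `borelKolyvaginInputs_of_cmRamified` (`W(K)[p^M] = 0 ∀ M`, `p ∤ d_K`, `p ∤ #𝓞_K^×`, `ord_p ∏ c_ℓ = 0`).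

What is NOT here: the Euler-system side of S2 (derivative classes with `𝓞_𝔭`-coefficients, the visibility device (γ), the local conditions
at `v ∣ p` for additive `W`), Sah's lemma itself, anything on (4)/regularity. beyond-print theorem: NO. BSD is not proved by any of this;
no summit statement is proved by this seat.

References: [GrossLMS1991] §1, §2, §4 Lemma 4.3, §9; [GrigorovJorzaPatrikisSteinTarnita2009] Props. 5.2–5.4; [LawsonWuthrich2016] §1;
[SerreLocalFields1979] IV §4 Prop. 17–18; [SilvermanATAEC1994] II.6.4, IV.9.2(d); [SilvermanAEC2009] VII.7.2; [JetchevSkinnerWan2017] §7.4.1;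
[Jetchev2008] Thm. 1.1.
-/

-- the summit namespace `Summit.BirchSwinnertonDyer.BirchSwinnertonDyer` repeats the problem name by design (D-0017)
set_option linter.dupNamespace false
set_option autoImplicit false

noncomputable section

open scoped Classical

open WeierstrassCurve NumberField Field IsDedekindDomain IsDedekindDomain.HeightOneSpectrum
  Literature.NumberTheory.EllipticCurves
  Literature.NumberTheory.EllipticCurves.Rank1Residual
  Literature.NumberTheory.GaloisRepresentations
  Literature.NumberTheory.QuadraticFields
  Summit.BirchSwinnertonDyer.Rank1Residual.X12.O11
  Summit.BirchSwinnertonDyer.BirchSwinnertonDyer.Theorems.PrintCFram.RationalLine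
  Summit.BirchSwinnertonDyer.BirchSwinnertonDyer.Theorems.PrintCFram.LineCharacter
  Summit.BirchSwinnertonDyer.BirchSwinnertonDyer.Theorems.EisensteinPrimesMuLambda

namespace Summit.BirchSwinnertonDyer.BirchSwinnertonDyer.Theorems.PrintCFram.BorelTorsion

/-! ## §5 On the frames of the crux: the Heegner field of every datum, and the Tamagawa-free currency of S2 / S3 -/

section Frames

variable (W : WeierstrassCurve ℚ) [W.IsElliptic] (p : ℕ) [hp : Fact p.Prime]

/-- **The Heegner field of any frame has no `W`-rational `p`-torsion** (it is imaginary quadratic; no use of the Heegner hypothesis is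
even needed — but note that it also makes `K''` unramified at `p ∣ N_W`, `isUnramifiedIn_of_satisfiesHeegnerHypothesis_of_dvd`, so the
Galois form applies to every `K''_n` as well). The `E(K)[p] = 0` clause of `AdditiveCoStepLInputManinAt W p` / hypothesis (β) of the
line `borel_heegner_squeeze` (crux workfile `Lines/borel-heegner-squeeze-H1check.md` §(β)), discharged on the class.
[cite: GrossLMS1991, §2 (sentence after (2.2))] -/
theorem torsionBy_eq_bot_heegnerField_of_cmRamified (hCM : W.HasCM) (h5 : 5 ≤ p) (hram : CMRamified W p)
    {N : ℕ} (K : Type) [Field K] [NumberField K] (hK : IsImaginaryQuadratic K) (_hH : SatisfiesHeegnerHypothesis N K) :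
    AddSubgroup.torsionBy (W.baseChange K).toAffine.Point (p : ℤ) = ⊥ :=
  torsionBy_eq_bot_of_finrank_eq_two W p hCM h5 hram K hK.1

/-- **A point of the Heegner field with `p • P = 0` is `0`**, on the class (pointwise form for the frame binders `P : W(K'')`).
[cite: GrossLMS1991, §2 (sentence after (2.2))] -/
theorem eq_zero_of_prime_smul_eq_zero_of_cmRamified (hCM : W.HasCM) (h5 : 5 ≤ p) (hram : CMRamified W p)
    (K : Type) [Field K] [NumberField K] (hK : IsImaginaryQuadratic K) {P : (W.baseChange K).toAffine.Point}
    (hP : (p : ℤ) • P = 0) : P = 0 :=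
  eq_zero_of_smul_eq_zero_of_torsionBy_eq_bot (torsionBy_eq_bot_of_finrank_eq_two W p hCM h5 hram K hK.1) hP

/-- **The Tamagawa term of S2/S3 vanishes on the class**: `ord_p ∏_ℓ c_ℓ(W) = 0` for a CM curve and `p ≥ 5` (cell `bsd-cm`'s
`RouteU.not_dvd_tamagawaProduct_of_hasCM`: no multiplicative prime, Kodaira–Néron `c_ℓ ≤ 4 < p`). So the `2·ord_p ∏ c_ℓ` summand of
`SchneiderFree.Upper.IndexUpperBoundLeAt` / `SchneiderFree.IndexLowerBoundLeAt` — the summand that Jetchev's printed Theorem 1.1 does NOT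
deliver in sum form (barrier `StringentKolyvaginCapsAtMax`) — is absent here. [cite: SilvermanATAEC1994, Thm. II.6.4 and Cor. IV.9.2(d)] -/
theorem padicValNat_tamagawaProduct_eq_zero_of_hasCM (hCM : W.HasCM) (h5 : 5 ≤ p) :
    padicValNat p W.tamagawaProduct = 0 :=
  padicValNat.eq_zero_of_not_dvd (RouteU.not_dvd_tamagawaProduct_of_hasCM W hCM p hp.out h5)

/-- **S2 on the class is the bare Kolyvagin inequality at slack `s`:** `IndexUpperBoundLeAt W p K P s ↔
ord_p #Ш(W/K) + 2s ≤ 2·ord_p [W(K) : ℤP]`. [cite: JetchevSkinnerWan2017, §7.4.1] -/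
theorem indexUpperBoundLeAt_iff_of_hasCM (hCM : W.HasCM) (h5 : 5 ≤ p) (K : Type) [Field K] [NumberField K]
    (P : (W.baseChange K).toAffine.Point) (s : ℕ) :
    SchneiderFree.Upper.IndexUpperBoundLeAt W p K P s ↔
      padicValNat p (W.baseChange K).shaOrder + 2 * s ≤ 2 * padicValNat p (AddSubgroup.zmultiples P).index := by
  unfold SchneiderFree.Upper.IndexUpperBoundLeAt
  rw [padicValNat_tamagawaProduct_eq_zero_of_hasCM W p hCM h5, mul_zero, add_zero]

/-- **S3 (STEP L) on the class is the bare lower inequality at slack `s`:** `IndexLowerBoundLeAt W p K P s ↔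
2·ord_p [W(K) : ℤP] ≤ ord_p #Ш(W/K) + 2s`. [cite: JetchevSkinnerWan2017, §7.4.1] -/
theorem indexLowerBoundLeAt_iff_of_hasCM (hCM : W.HasCM) (h5 : 5 ≤ p) (K : Type) [Field K] [NumberField K]
    (P : (W.baseChange K).toAffine.Point) (s : ℕ) :
    SchneiderFree.IndexLowerBoundLeAt W p K P s ↔
      2 * padicValNat p (AddSubgroup.zmultiples P).index ≤ padicValNat p (W.baseChange K).shaOrder + 2 * s := by
  unfold SchneiderFree.IndexLowerBoundLeAt
  rw [padicValNat_tamagawaProduct_eq_zero_of_hasCM W p hCM h5, mul_zero, add_zero]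

end Frames

/-! ## §6 The Sah input for (α): a non-trivial HOMOTHETY of `W[p](ℚ̄)` inside `I_𝔓`, which is a square of `Γ_ℚ` -/

section Homothety

variable {M : Type*} [AddCommGroup M] {p : ℕ}

/-- **`a + N` with `N² = 0`.** If `φ` acts on `Φ ≤ M` by `a` and on `M/Φ` by `a`, then with `N Q = φ Q − a Q` (so `N(M) ⊆ Φ`, `N ∘ N = 0`):
`φ^[n] Q = aⁿ Q + (n aⁿ⁻¹) N Q` for `n ≥ 1`, written as `φ^[n+1] Q = a^{n+1} Q + ((n+1) aⁿ) (φ Q − a Q)`. [folklore] -/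
theorem iterate_succ_eq_of_scalar_line_and_quot (Φ : AddSubgroup M) (φ : M →+ M) {a : ℤ} (ha : ∀ P ∈ Φ, φ P = a • P)
    (hq : ∀ Q : M, φ Q - a • Q ∈ Φ) (n : ℕ) (Q : M) :
    φ^[n + 1] Q = (a ^ (n + 1)) • Q + (((n + 1 : ℕ) : ℤ) * a ^ n) • (φ Q - a • Q) := by
  induction n with
  | zero => simp
  | succ n ih =>
    rw [Function.iterate_succ_apply', ih, map_add, map_zsmul, map_zsmul, ha _ (hq Q)]
    have e : φ Q = a • Q + (φ Q - a • Q) := by abel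
    conv_lhs => rw [e]
    simp only [smul_add, smul_smul, Nat.cast_add, Nat.cast_one, pow_succ]
    have e2 : (((n : ℤ) + 1 + 1) * (a ^ n * a)) • (φ Q - a • Q) =
        (a ^ n * a) • (φ Q - a • Q) + (((n : ℤ) + 1) * a ^ n * a) • (φ Q - a • Q) := by
      rw [← add_smul]; congr 1; ring
    rw [e2]
    abel

/-- **The `p`-th iterate is the homothety `a^p`** when `M` is killed by `p`: the nilpotent part `p a^{p−1} N` dies. [folklore] -/
theorem iterate_prime_eq_smul_of_scalar_line_and_quot (hp : p.Prime) (hM : ∀ Q : M, (p : ℤ) • Q = 0) (Φ : AddSubgroup M)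
    (φ : M →+ M) {a : ℤ} (ha : ∀ P ∈ Φ, φ P = a • P) (hq : ∀ Q : M, φ Q - a • Q ∈ Φ) (Q : M) :
    φ^[p] Q = (a ^ p) • Q := by
  obtain ⟨k, hk⟩ : ∃ k, p = k + 1 := ⟨p - 1, (Nat.sub_add_cancel hp.one_le).symm⟩
  rw [hk, iterate_succ_eq_of_scalar_line_and_quot Φ φ ha hq k Q, ← hk, mul_comm, mul_smul, hM, smul_zero, add_zero]

variable (W : WeierstrassCurve ℚ) [W.IsElliptic] (p) [hp : Fact p.Prime]

/-- **A non-trivial homothety of `W[p](ℚ̄)` in the inertia group at `p`, which is a square of `Γ_ℚ`.** For `W/ℚ` with CM, `p ≥ 5`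
CM-ramified, a place `v ∋ p` and `𝔓 ∣ v`: there are `g ∈ I_𝔓`, of the form `h·h`, and an integer `c ≢ 1 (mod p)` with `g • Q = c • Q` for
EVERY `Q ∈ W[p](ℚ̄)` (`g = (τ²)^p`, `c = a^p ≡ a ≡ ±2`: the unipotent part of `τ²` is killed by the `p`-th power). Hence for every field `L`
with `g ∈ res(Γ_L)` (every quadratic `L`; every Galois `L` unramified at `p`) the image of `Γ_L` in `Aut W[p]` contains a CENTRAL element
acting as `c ≠ 1` — the input of Sah's lemma for `H^i(Gal(L(W[p])/L), W[p]) = 0`, `i ≥ 1` (hypothesis (α) of the line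
`borel_heegner_squeeze`, crux workfile `Lines/borel-heegner-squeeze-H1check.md` §(α); Gross 1991 §9 / Lawson–Wuthrich 2016).
[cite: GrossLMS1991, §9 (restriction to K(E_p))] [cite: LawsonWuthrich2016, §1 (vanishing of H¹(G, E[p]) in the presence of homotheties)]
[cite: SerreLocalFields1979, Ch. IV §4, Prop. 17–18] -/
theorem exists_sq_mem_inertia_homothety (hCM : W.HasCM) (h5 : 5 ≤ p) (hram : CMRamified W p)
    {v : HeightOneSpectrum (𝓞 ℚ)} (hv : ((p : ℕ) : 𝓞 ℚ) ∈ v.asIdeal)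
    {𝔓 : Ideal (absIntegers (𝓞 ℚ) ℚ)} (h𝔓 : 𝔓 ∈ v.primesAbove) :
    ∃ g ∈ 𝔓.inertia (absoluteGaloisGroup ℚ), (∃ h : absoluteGaloisGroup ℚ, g = h * h) ∧
      ∃ c : ℤ, ¬ (p : ℤ) ∣ c - 1 ∧ ∀ Q : W.geomTorsion (p : ℤ), g • Q = c • Q := by
  have hpr : p.Prime := hp.out
  obtain ⟨Φ, hstab, hcard⟩ := exists_rationalLine_of_cmRamified W p hCM h5 hram
  have hΦ : IsRationalLine W p Φ := ⟨hcard, hstab⟩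
  obtain ⟨τ, hτI, a, ha, hq, haa⟩ := exists_mem_inertia_sq_scalar W p hCM h5 hram hΦ hv h𝔓
  refine ⟨(τ * τ) ^ p, Subgroup.pow_mem _ (Subgroup.mul_mem _ hτI hτI) p, ⟨τ ^ p, ?_⟩, a ^ p, ?_, fun Q ↦ ?_⟩
  · rw [← pow_two, ← pow_mul, ← pow_add, two_mul]
  · -- `a^p ≡ a ≢ 1 (mod p)`
    intro h
    have h1 : ((a : ℤ) : ZMod p) = 1 := by
      have := (ZMod.intCast_zmod_eq_zero_iff_dvd (a ^ p - 1) p).mpr h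
      rw [Int.cast_sub, Int.cast_pow, ZMod.pow_card, Int.cast_one, sub_eq_zero] at this
      exact this
    have h41 : (4 : ZMod p) = 1 := by rw [← haa]; push_cast; rw [h1, mul_one]
    have h3 : ((3 : ℕ) : ZMod p) = 0 := by
      have e : ((3 : ℕ) : ZMod p) = 4 - 1 := by norm_num
      rw [e, h41, sub_self]
    rw [ZMod.natCast_eq_zero_iff] at h3
    have : p ≤ 3 := Nat.le_of_dvd (by norm_num) h3
    omega
  · have hM : ∀ R : W.geomTorsion (p : ℤ), (p : ℤ) • R = 0 := fun R ↦ by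
      rw [← Subtype.coe_inj, AddSubgroupClass.coe_zsmul, ZeroMemClass.coe_zero]
      exact (Submodule.mem_torsionBy_iff _ _).mp R.2
    let φ : W.geomTorsion (p : ℤ) →+ W.geomTorsion (p : ℤ) := DistribSMul.toAddMonoidHom (W.geomTorsion (p : ℤ)) (τ * τ)
    have hit : ∀ (n : ℕ) (R : W.geomTorsion (p : ℤ)), ((τ * τ) ^ n) • R = φ^[n] R := by
      intro n
      induction n with
      | zero => intro R; rw [pow_zero, one_smul, Function.iterate_zero_apply]
      | succ n ih => intro R; rw [pow_succ, mul_smul, ih, Function.iterate_succ_apply]; rfl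
    rw [hit, iterate_prime_eq_smul_of_scalar_line_and_quot hpr hM Φ φ ha hq Q]

end Homothety

/-! ## §7 The field-side binders of S2/S3 at the Heegner field of a class member: `p ∣ N_W`, `p ∤ d_K`, `p ∤ #𝓞_K^×`, `K` unramified at `p` -/

section HeegnerField

variable (W : WeierstrassCurve ℚ) [W.IsElliptic] [W.IsGloballyMinimal] (p : ℕ) [hp : Fact p.Prime]

/-- **`p ∣ N_W` on the class**: a CM-ramified prime is additive (`X12.addv_of_hasCM_of_cmRamified'`), hence divides the conductor.
[cite: SilvermanAEC2009, Cor. VII.7.2] [cite: SilvermanATAEC1994, II.6.4 and App. A §3] -/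
theorem dvd_conductorNorm_of_cmRamified (hCM : W.HasCM) (hram : CMRamified W p) : p ∣ W.conductorNorm ℤ :=
  (W.dvd_conductorNorm_iff_not_hasGoodReductionAtPrime p).mpr (Summit.BirchSwinnertonDyer.Rank1Residual.X12.addv_of_hasCM_of_cmRamified' W p hCM hram).1

/-- **At the Heegner field `K` of a class member (Heegner hypothesis for `N_W`): `p ∤ d_K` and `p ∤ #𝓞_K^×`** — the two field-side
binders `Odd`-free of `stub_kolyvaginUpper_borelCM` / `stub_indexLower_borelCM` (`¬ p ∣ Units.torsionOrder K`) and of Kriz–Li / Jetchev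
(`p` split, `p ∤ d_K`), discharged on the class: `p ∣ N_W` splits in `K`. [cite: GrossLMS1991, §1 (p. 235)] -/
theorem not_dvd_discr_and_not_dvd_torsionOrder_heegnerField_of_cmRamified (hCM : W.HasCM) (h5 : 5 ≤ p) (hram : CMRamified W p)
    (K : Type) [Field K] [NumberField K] (hK : IsImaginaryQuadratic K) (hH : SatisfiesHeegnerHypothesis (W.conductorNorm ℤ) K) :
    ¬ (p : ℤ) ∣ NumberField.discr K ∧ ¬ p ∣ Units.torsionOrder K :=
  Summit.BirchSwinnertonDyer.Rank1Residual.X11b.Three.not_dvd_discr_and_not_dvd_torsionOrder_of_heegner hK hH (by omega)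
    (dvd_conductorNorm_of_cmRamified W p hCM hram)

/-- **The Heegner field of a class member is unramified at `p`** (every place `v ∋ p` of `ℚ`), so the Galois form
`torsionBy_eq_bot_of_isGalois_of_isUnramifiedIn` applies to it and — by multiplicativity of ramification indices — is the shape needed
for its ring class fields of conductor prime to `p`. [cite: GrossLMS1991, §1 (p. 235)] -/
theorem isUnramifiedIn_heegnerField_of_cmRamified (hCM : W.HasCM) (hram : CMRamified W p)
    (K : Type) [Field K] [NumberField K] (hK : IsImaginaryQuadratic K) (hH : SatisfiesHeegnerHypothesis (W.conductorNorm ℤ) K) :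
    ∀ v : HeightOneSpectrum (𝓞 ℚ), ((p : ℕ) : 𝓞 ℚ) ∈ v.asIdeal → Algebra.IsUnramifiedIn (𝓞 K) v.asIdeal :=
  Summit.BirchSwinnertonDyer.Rank1Residual.X11b.isUnramifiedIn_of_satisfiesHeegnerHypothesis_of_dvd hK hH hp.out
    (dvd_conductorNorm_of_cmRamified W p hCM hram)

/-- **All inputs of the restriction step at once, at any frame of the crux** (`K` imaginary quadratic, Heegner for `N_W`; `W` CM,
`p ≥ 5` CM-ramified): `W(K)[p^M] = 0` for every `M`, `p ∤ d_K`, `p ∤ #𝓞_K^×`, and `ord_p ∏ c_ℓ(W) = 0`.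
[cite: GrossLMS1991, §2 (after (2.2)) and §4 Lemma 4.3] [cite: GrigorovJorzaPatrikisSteinTarnita2009, Props. 5.2–5.4] -/
theorem borelKolyvaginInputs_of_cmRamified (hCM : W.HasCM) (h5 : 5 ≤ p) (hram : CMRamified W p)
    (K : Type) [Field K] [NumberField K] (hK : IsImaginaryQuadratic K) (hH : SatisfiesHeegnerHypothesis (W.conductorNorm ℤ) K) :
    (∀ M : ℕ, AddSubgroup.torsionBy (W.baseChange K).toAffine.Point ((p : ℤ) ^ M) = ⊥) ∧
      ¬ (p : ℤ) ∣ NumberField.discr K ∧ ¬ p ∣ Units.torsionOrder K ∧ padicValNat p W.tamagawaProduct = 0 :=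
  ⟨fun M ↦ torsionBy_pow_eq_bot_of_finrank_eq_two W p hCM h5 hram K hK.1 M,
    (not_dvd_discr_and_not_dvd_torsionOrder_heegnerField_of_cmRamified W p hCM h5 hram K hK hH).1,
    (not_dvd_discr_and_not_dvd_torsionOrder_heegnerField_of_cmRamified W p hCM h5 hram K hK hH).2,
    padicValNat_tamagawaProduct_eq_zero_of_hasCM W p hCM h5⟩

end HeegnerField

end Summit.BirchSwinnertonDyer.BirchSwinnertonDyer.Theorems.PrintCFram.BorelTorsion

end
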